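import Mathlib
import Literature.AlgebraicGeometry.Resolution.CobordantGame
import Literature.AlgebraicGeometry.Resolution.FormalCoordinateChange
import Summits.ResolutionOfSingularities.ResolutionOfSingularities.Theorems.WeightedInvariantLocalWeightedDropConeDichotomyAux

/-!
# The tangent quadric of a singular germ: hyperbolic pair or square of a linear form

Crux `LocalWeightedDrop` (stmt-ResolutionOfSingularities-8899, route
ResolutionOfSingularities/WeightedInvariant), line `hasse-ridge-face-selection`, registered stub
`stub_coneDichotomy` of the skeleton `LocalWeightedDrop`: over an algebraically closed field `k` of ANY
characteristic, the degree-`2` initial form `q` of a singular germ `f ∈ k[[x₀,…,x_{n+1}]]` either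
contains a HYPERBOLIC PAIR — after an invertible LINEAR coordinate change the coefficients of `x₀²` and
`x₁²` of `f∘θ` vanish and that of `x₀x₁` does not — or `q = ℓ²` is the square of a linear form
(coefficientwise on all degree-`2` exponents `eᵢ + eⱼ`; `ℓ = 0` allowed).

Proof (char-free linear algebra of quadratic forms `Q(v) = v ⬝ᵥ c *ᵥ v`, polar form
`B(v,w) = v ⬝ᵥ c *ᵥ w + w ⬝ᵥ c *ᵥ v`; the degree-`2` bookkeeping `stub_coneDichotomyQuadSubst` — the
degree-`2` coefficients of `f ∘ (x ↦ M x)` are `Q(col_i M)` and `B(col_i M, col_j M)` — is the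
registered sub-goal proved in the auxiliary file `…ConeDichotomyAux`).
* HYPERBOLIC CASE (`exists_matrix_of_hyperbolic`): an isotropic `v` with `B(v,u) ≠ 0` gives the
  isotropic `e₁ = B(v,u)u - Q(u)v` with `B(v,e₁) = B(v,u)² ≠ 0`; `v, e₁` are linearly independent,
  extend to a basis (`exists_linearIndependent_snoc_of_lt_finrank`) and take the matrix `M` with these
  columns (`Matrix.linearIndependent_cols_iff_isUnit`).
* SQUARE CASE (`square_of_rows_dependent`): if every isotropic vector is in the polar radical, then for
  `i ≠ j` a projective zero `[s:t]` of the binary form `Q(s eᵢ + t eⱼ)` (algebraically closed field,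
  `binary_root`) makes the rows `i`, `j` of the polar matrix `S = (B(eᵢ,eⱼ))` linearly dependent; in
  characteristic `2` (`S` alternating) this forces `S = 0` off the diagonal and `ℓᵢ = √Q(eᵢ)` works;
  otherwise `S = 0` (and `ℓ = 0`), or `S` is the rank-one symmetric matrix `S_ij = a_i a_j / a_p` for a
  non-zero row `a = S_p`, and `ℓ = a / √(2a_p)`.
-/

set_option linter.dupNamespace false -- mandated namespace of this single-conjunct summit

namespace Summit.ResolutionOfSingularities.ResolutionOfSingularities.Theorems

open Literature.AlgebraicGeometry.Resolution
open MvPowerSeries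
open scoped Matrix

namespace ConeDichotomy

variable {k : Type*} [Field k] {N : ℕ}

/-- A binary quadratic form over an algebraically closed field has a projective zero. -/
theorem binary_root [IsAlgClosed k] (α β γ : k) :
    ∃ s t : k, (s ≠ 0 ∨ t ≠ 0) ∧ s ^ 2 * α + t ^ 2 * γ + s * t * β = 0 := by
  by_cases hα : α = 0
  · exact ⟨1, 0, Or.inl one_ne_zero, by simp [hα]⟩
  · obtain ⟨x, hx⟩ := IsAlgClosed.exists_root
      (Polynomial.C α * Polynomial.X ^ 2 + Polynomial.C β * Polynomial.X + Polynomial.C γ)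
      (by rw [Polynomial.degree_quadratic hα]; decide)
    refine ⟨x, 1, Or.inr one_ne_zero, ?_⟩
    simp only [Polynomial.IsRoot.def, Polynomial.eval_add, Polynomial.eval_mul, Polynomial.eval_C,
      Polynomial.eval_pow, Polynomial.eval_X] at hx
    linear_combination hx

/-- SQUARE CASE.  A symmetric matrix `S` with diagonal `2q`, any two distinct rows of which are
linearly dependent, is over an algebraically closed field the polar matrix of the square of a linear
form `ℓ` with `ℓᵢ² = qᵢ`. -/
theorem square_of_rows_dependent [IsAlgClosed k] (q : Fin N → k) (S : Fin N → Fin N → k)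
    (hdiag : ∀ i, S i i = 2 * q i) (hsymm : ∀ i j, S i j = S j i)
    (hdep : ∀ i j, i ≠ j → ∃ s t : k, (s ≠ 0 ∨ t ≠ 0) ∧ ∀ m, s * S i m + t * S j m = 0) :
    ∃ ℓ : Fin N → k, (∀ i, q i = ℓ i * ℓ i) ∧ ∀ i j, i ≠ j → S i j = ℓ i * ℓ j + ℓ j * ℓ i := by
  by_cases h2 : (2 : k) = 0
  · -- characteristic 2: `S` is alternating, hence zero off the diagonal
    have hoff : ∀ i j, i ≠ j → S i j = 0 := by
      intro i j hij
      by_contra hne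
      obtain ⟨s, t, hst, hm⟩ := hdep i j hij
      have hi := hm i
      have hj := hm j
      rw [hdiag i, h2, zero_mul, mul_zero, zero_add, hsymm j i] at hi
      rw [hdiag j, h2, zero_mul, mul_zero, add_zero] at hj
      rcases hst with hs | ht
      · exact hs ((mul_eq_zero.mp hj).resolve_right hne)
      · exact ht ((mul_eq_zero.mp hi).resolve_right hne)
    choose r hr using fun i => IsAlgClosed.exists_eq_mul_self (q i)
    refine ⟨r, hr, fun i j hij => ?_⟩
    rw [hoff i j hij, mul_comm (r j), ← two_mul, h2, zero_mul]
  · by_cases hS : ∀ i j, S i j = 0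
    · refine ⟨0, fun i => ?_, fun i j _ => by simp [hS]⟩
      have h := hdiag i
      rw [hS] at h
      simpa using ((mul_eq_zero.mp h.symm).resolve_left h2)
    · push Not at hS
      obtain ⟨p, m₀, hpm⟩ := hS
      -- every row is a multiple of the row `p`
      have hrow : ∀ i, ∃ μ : k, ∀ m, S i m = μ * S p m := by
        intro i
        by_cases hip : i = p
        · exact ⟨1, fun m => by rw [hip, one_mul]⟩
        · obtain ⟨s, t, hst, hm⟩ := hdep i p hip
          have hs : s ≠ 0 := by
            rintro rfl
            have h0 := hm m₀
            rw [zero_mul, zero_add] at h0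
            rcases hst with h | h
            · exact h rfl
            · exact hpm ((mul_eq_zero.mp h0).resolve_left h)
          refine ⟨-(t / s), fun m => ?_⟩
          have h1 := hm m
          field_simp
          linear_combination h1
      choose μ hμ using hrow
      have hpp : S p p ≠ 0 := by
        intro h0
        apply hpm
        rw [hsymm p m₀, hμ m₀ p, h0, mul_zero]
      have hfac : ∀ i m, S i m * S p p = S p i * S p m := by
        intro i m
        have hb := hμ i p
        rw [hsymm i p] at hb
        rw [hμ i m, hb]
        ring
      have h2S : 2 * S p p ≠ 0 := mul_ne_zero h2 hpp
      obtain ⟨ρ, hρ⟩ := IsAlgClosed.exists_eq_mul_self ((2 * S p p)⁻¹)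
      refine ⟨fun i => ρ * S p i, fun i => ?_, fun i j _ => ?_⟩
      · have h := hfac i i
        rw [hdiag i] at h
        calc q i = q i * (2 * S p p) * (2 * S p p)⁻¹ := (mul_inv_cancel_right₀ h2S _).symm
          _ = (2 * q i * S p p) * (ρ * ρ) := by rw [← hρ]; ring
          _ = S p i * S p i * (ρ * ρ) := by rw [h]
          _ = _ := by ring
      · have h := hfac i j
        calc S i j = S i j * (2 * S p p) * (2 * S p p)⁻¹ := (mul_inv_cancel_right₀ h2S _).symm
          _ = (S i j * S p p) * 2 * (ρ * ρ) := by rw [← hρ]; ring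
          _ = S p i * S p j * 2 * (ρ * ρ) := by rw [h]
          _ = _ := by ring

/-- Extending a linearly independent pair in `k^{n+2}` to linearly independent families of every
length `m + 2 ≤ n + 2` with the same first two vectors. -/
theorem exists_linearIndependent_extend_pair {n : ℕ} {v e : Fin (n + 2) → k}
    (h : LinearIndependent k ![v, e]) (m : ℕ) (hm : m ≤ n) :
    ∃ b : Fin (m + 2) → (Fin (n + 2) → k), LinearIndependent k b ∧ b 0 = v ∧ b 1 = e := by
  induction m with
  | zero => exact ⟨![v, e], h, rfl, rfl⟩
  | succ m ih =>
    obtain ⟨b, hb, hb0, hb1⟩ := ih (Nat.le_of_succ_le hm)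
    have hlt : m + 2 < Module.finrank k (Fin (n + 2) → k) := by
      rw [Module.finrank_fin_fun]; omega
    obtain ⟨x, hx⟩ := exists_linearIndependent_snoc_of_lt_finrank hb hlt
    refine ⟨Fin.snoc b x, hx, ?_, ?_⟩
    · rw [Fin.snoc_apply_zero]; exact hb0
    · rw [← Fin.castSucc_one, Fin.snoc_castSucc]; exact hb1

/-- HYPERBOLIC CASE.  An isotropic vector `v` (`Q(v) = 0`) outside the polar radical (`B(v,u) ≠ 0`)
is the first column of an invertible matrix whose first two columns `v, e₁` form a hyperbolic pair:
`Q(v) = Q(e₁) = 0`, `B(v,e₁) ≠ 0`. -/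
theorem exists_matrix_of_hyperbolic {n : ℕ} (c : Matrix (Fin (n + 2)) (Fin (n + 2)) k)
    {v u : Fin (n + 2) → k} (hv : v ⬝ᵥ c *ᵥ v = 0) (hu : v ⬝ᵥ c *ᵥ u + u ⬝ᵥ c *ᵥ v ≠ 0) :
    ∃ M : Matrix (Fin (n + 2)) (Fin (n + 2)) k, IsUnit M.det ∧ Mᵀ 0 ⬝ᵥ c *ᵥ Mᵀ 0 = 0 ∧
      Mᵀ 1 ⬝ᵥ c *ᵥ Mᵀ 1 = 0 ∧ Mᵀ 0 ⬝ᵥ c *ᵥ Mᵀ 1 + Mᵀ 1 ⬝ᵥ c *ᵥ Mᵀ 0 ≠ 0 := by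
  set e₁ : Fin (n + 2) → k := (v ⬝ᵥ c *ᵥ u + u ⬝ᵥ c *ᵥ v) • u + (-(u ⬝ᵥ c *ᵥ u)) • v with he₁
  have hQ1 : e₁ ⬝ᵥ c *ᵥ e₁ = 0 := by
    rw [he₁, qf_lin, hv]
    ring
  have hB1 : v ⬝ᵥ c *ᵥ e₁ + e₁ ⬝ᵥ c *ᵥ v =
      (v ⬝ᵥ c *ᵥ u + u ⬝ᵥ c *ᵥ v) * (v ⬝ᵥ c *ᵥ u + u ⬝ᵥ c *ᵥ v) := by
    rw [he₁, bf_lin_right, hv]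
    ring
  have hB1' : v ⬝ᵥ c *ᵥ e₁ + e₁ ⬝ᵥ c *ᵥ v ≠ 0 := by rw [hB1]; exact mul_ne_zero hu hu
  have hv0 : v ≠ 0 := by
    rintro rfl
    simp at hu
  have hli : LinearIndependent k ![v, e₁] := by
    rw [LinearIndependent.pair_iff]
    intro s t hst
    have ht : t = 0 := by
      have h := congrArg (fun x => v ⬝ᵥ c *ᵥ x + x ⬝ᵥ c *ᵥ v) hst
      simp only [bf_lin_right, hv, hB1, Matrix.mulVec_zero, dotProduct_zero, zero_dotProduct,
        add_zero, mul_zero, zero_add] at h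
      exact (mul_eq_zero.mp h).resolve_right (mul_ne_zero hu hu)
    subst ht
    rw [zero_smul, add_zero] at hst
    exact ⟨(smul_eq_zero.mp hst).resolve_right hv0, rfl⟩
  obtain ⟨b, hb, hb0, hb1⟩ := exists_linearIndependent_extend_pair hli n le_rfl
  refine ⟨(Matrix.of b)ᵀ, ?_, ?_, ?_, ?_⟩
  · rw [← Matrix.isUnit_iff_isUnit_det]
    exact Matrix.linearIndependent_cols_iff_isUnit.mp hb
  · rw [Matrix.transpose_transpose]; change b 0 ⬝ᵥ c *ᵥ b 0 = 0; rw [hb0]; exact hv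
  · rw [Matrix.transpose_transpose]; change b 1 ⬝ᵥ c *ᵥ b 1 = 0; rw [hb1]; exact hQ1
  · rw [Matrix.transpose_transpose]; change b 0 ⬝ᵥ c *ᵥ b 1 + b 1 ⬝ᵥ c *ᵥ b 0 ≠ 0
    rw [hb0, hb1]; exact hB1'

/-- THE DICHOTOMY for a coefficient matrix `c` over an algebraically closed field: a hyperbolic pair
after an invertible linear change of coordinates, or `Q(v) = v ⬝ᵥ c *ᵥ v` is the square of a linear
form `ℓ` (as polynomials: `c_ii = ℓᵢ²`, `c_ij + c_ji = 2ℓᵢℓⱼ`). -/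
theorem dichotomy [IsAlgClosed k] {n : ℕ} (c : Matrix (Fin (n + 2)) (Fin (n + 2)) k) :
    (∃ M : Matrix (Fin (n + 2)) (Fin (n + 2)) k, IsUnit M.det ∧ Mᵀ 0 ⬝ᵥ c *ᵥ Mᵀ 0 = 0 ∧
      Mᵀ 1 ⬝ᵥ c *ᵥ Mᵀ 1 = 0 ∧ Mᵀ 0 ⬝ᵥ c *ᵥ Mᵀ 1 + Mᵀ 1 ⬝ᵥ c *ᵥ Mᵀ 0 ≠ 0) ∨
    ∃ ℓ : Fin (n + 2) → k, ∀ i j : Fin (n + 2), (if i = j then c i i else c i j + c j i) =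
      if i = j then ℓ i * ℓ i else ℓ i * ℓ j + ℓ j * ℓ i := by
  classical
  by_cases hH : ∃ v u : Fin (n + 2) → k, v ⬝ᵥ c *ᵥ v = 0 ∧ v ⬝ᵥ c *ᵥ u + u ⬝ᵥ c *ᵥ v ≠ 0
  · obtain ⟨v, u, hv, hu⟩ := hH
    exact Or.inl (exists_matrix_of_hyperbolic c hv hu)
  · push Not at hH
    right
    obtain ⟨ℓ, hq, hS⟩ := square_of_rows_dependent
      (fun i => Pi.single i 1 ⬝ᵥ c *ᵥ Pi.single i 1)
      (fun i j => Pi.single i 1 ⬝ᵥ c *ᵥ Pi.single j 1 + Pi.single j 1 ⬝ᵥ c *ᵥ Pi.single i 1)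
      (fun i => (two_mul _).symm) (fun i j => add_comm _ _) (fun i j _ => by
        obtain ⟨s, t, hst, hroot⟩ := binary_root (Pi.single i 1 ⬝ᵥ c *ᵥ Pi.single i 1)
          (Pi.single i 1 ⬝ᵥ c *ᵥ Pi.single j 1 + Pi.single j 1 ⬝ᵥ c *ᵥ Pi.single i 1)
          (Pi.single j 1 ⬝ᵥ c *ᵥ Pi.single j 1)
        refine ⟨s, t, hst, fun m => ?_⟩
        have hiso : (s • Pi.single i 1 + t • Pi.single j 1) ⬝ᵥ c *ᵥ
            (s • Pi.single i 1 + t • Pi.single j 1) = 0 := by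
          rw [qf_lin]; linear_combination hroot
        have := hH _ (Pi.single m 1) hiso
        rwa [bf_lin_left] at this)
    refine ⟨ℓ, fun i j => ?_⟩
    split_ifs with hij
    · rw [← qf_single c i]; exact hq i
    · rw [← bf_single_single c i j]; exact hS i j hij

end ConeDichotomy

open ConeDichotomy in
/-- CONE DICHOTOMY (registered stub `stub_coneDichotomy` of the skeleton `LocalWeightedDrop`, line
`hasse-ridge-face-selection`).  Over an algebraically closed field of any characteristic, for a
singular germ `f ∈ k[[x₀,…,x_{n+1}]]` with degree-`2` initial form `q`: EITHER after a legal (linear,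
invertible) coordinate change `θ` the coefficients of `x₀²` and `x₁²` of `f∘θ` vanish and that of
`x₀x₁` does not (a hyperbolic pair: an isotropic vector outside the polar radical, completed to a
hyperbolic partner and to a basis), OR `q` is the square of a linear form `ℓ = ∑ ℓ_l x_l`,
coefficientwise on all degree-`2` exponents `eᵢ + eⱼ` (`ℓ = 0` allowed). -/
theorem stub_coneDichotomy : ∀ (k : Type) [Field k] [IsAlgClosed k] (n : ℕ) (f : MvPowerSeries (Fin (n + 2)) k),
    CobordantGame.IsSingular k f →
    (∃ θ : Fin (n + 2) → MvPowerSeries (Fin (n + 2)) k, (∀ i, MvPowerSeries.constantCoeff (θ i) = 0) ∧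
      IsUnit (Matrix.det (Matrix.of fun i j => MvPowerSeries.coeff (Finsupp.single j 1) (θ i))) ∧
      MvPowerSeries.coeff (Finsupp.single 0 2) (MvPowerSeries.subst θ f) = 0 ∧
      MvPowerSeries.coeff (Finsupp.single 1 2) (MvPowerSeries.subst θ f) = 0 ∧
      MvPowerSeries.coeff (Finsupp.single 0 1 + Finsupp.single 1 1) (MvPowerSeries.subst θ f) ≠ 0) ∨
    (∃ ℓ : Fin (n + 2) → k, ∀ i j : Fin (n + 2),
      MvPowerSeries.coeff (Finsupp.single i 1 + Finsupp.single j 1) f =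
        MvPowerSeries.coeff (Finsupp.single i 1 + Finsupp.single j 1)
          ((∑ l, MvPowerSeries.C (ℓ l) * MvPowerSeries.X l) ^ 2)) := by
  intro k _ _ n f hf
  obtain ⟨-, hf0, hf1⟩ := hf
  obtain ⟨c, hc⟩ := exists_quadMat f
  rcases dichotomy c with ⟨M, hdet, h0, h1, h01⟩ | ⟨ℓ, hℓ⟩
  · refine Or.inl ⟨FormalCoordChange.linSubst M, constantCoeff_linSubst M, ?_, ?_, ?_, ?_⟩
    · rw [linMat_linSubst]; exact hdet
    · rw [single_two_eq, stub_coneDichotomyQuadSubst k (n + 2) M c f hf0 hf1 hc, if_pos rfl]; exact h0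
    · rw [single_two_eq, stub_coneDichotomyQuadSubst k (n + 2) M c f hf0 hf1 hc, if_pos rfl]; exact h1
    · rw [stub_coneDichotomyQuadSubst k (n + 2) M c f hf0 hf1 hc, if_neg Fin.zero_ne_one]; exact h01
  · refine Or.inr ⟨ℓ, fun i j => ?_⟩
    rw [sq_linear_eq_quadP, coeff_pair_quadP, hc, hℓ i j]
    simp only [Matrix.of_apply]

end Summit.ResolutionOfSingularities.ResolutionOfSingularities.Theorems
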